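import Summits.PneNP.PneNP.Theorems.PhaseTwinsPolyDepthTwinsAboveDefs

/-!
# `PolyDepthTwinsAbove` (stmt-PneNP-2719), negative side II: the pair coupling of `stub_tseitinGap` is load-bearing

Support file of the crux disprover (cdisprove seat, gen 2) for the line `parity-wired-ports` of the crux
`PhaseTwins.PolyDepthTwinsAbove`.  The registered stub `stub_tseitinGap` of
`Cruxes/PolyDepthTwinsAbove/Lines/parity-wired-ports.lean` asserts, under the coupling hypothesis
`hcouple : κ₂ (M log ρ_F + g) ≤ κ₁ log B`, that every phase vector under the odd charge `1_{w₀}`, boosted by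
`e^{κ₂ g}` (`g = Ψ(0) − Ψ(1)`), weighs at most the reference vector under charge `0`.  Here:

* `cxWeight_one_eq` — the one-leg TSEITIN COVARIANCE of the CFI complex: moving the charge is the same as
  flipping the bit of the third leg's ends (`cxWeight 1 lam x = cxWeight 0 lam (x ∘ flip₃)`, the flip written inline —
  this file declares NO definitions); in particular the
  complex factor at a CONSTANT port pattern does not see the charge (`cxW_const_eq`);
* `cxWeight_mono`, `one_le_cxWeight`, `cxW_le_allMinus` — the complex factor is coefficientwise monotone in the
  vacancies, hence maximal when all six ports are in phase `−`;
* `tseitinGap_false_without_coupling` — with the pair coupling switched off (`κ₁ = 0`, so `hcouple` is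
  unavailable as soon as `κ₂ ≥ 1`) the conclusion of `stub_tseitinGap` is FALSE for every base `R`, every
  `w₀`, every `0 < q⁻ < q⁺ < 1`, `λ > 0`, `κ₂ ≥ 1`, even granted strict charge visibility `Ψ(1) < Ψ(0)`:
  the all-`−` phase vector is charge-blind and maximal, so it beats the reference by the full factor `e^{κ₂ g}`.
  ("Aligned pairs beat the reference once nothing penalises alignment" — the numerical finding of the gen-1
  seat, kit-free and kernel-checked.)  Any proof of `stub_tseitinGap` must therefore spend `hcouple`; the
  design constraint it certifies is `κ₁ log B > 0` per canonical pair whenever `κ₂ ≥ 1`.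
[folklore]
-/

noncomputable section

open scoped Classical BigOperators

set_option linter.dupNamespace false

namespace Summit.PneNP.PneNP.Theorems.PolyDepthTwinsAbove.Negative

open Summit.PneNP.PneNP.Cruxes.PolyDepthTwinsAbove.ParityWiredPorts
open Literature.Computability.Complexity.Expander (RotGraph)
open Literature.ModelTheory.FiniteModelTheory.TseitinColouring (Dart)
open Literature.ModelTheory.FiniteModelTheory.CFIMatching (bit Canon zmod2_add_self zmod2_eq_zero_or_one)

/-! ## Tseitin covariance of the complex at one leg -/

/-- The represented bits under charge `1` are those under charge `0` with the third one flipped. -/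
theorem bit_one_eq (S' : Fin 2 → ZMod 2) (i : Fin 3) :
    bit 1 S' i = bit 0 S' i + if i = 2 then 1 else 0 := by
  unfold bit
  by_cases h0 : i = 0
  · subst h0; simp
  · by_cases h1 : i = 1
    · subst h1; simp
    · have h2 : i = 2 := by
        rcases i with ⟨i, hi⟩
        have : i ≠ 0 := fun h => h0 (Fin.ext (by simp [h]))
        have : i ≠ 1 := fun h => h1 (Fin.ext (by simp [h]))
        exact Fin.ext (by simp; omega)
      subst h2
      simp
      ring

/-- **Tseitin covariance at one leg.** Moving the local charge of the CFI complex from `1` to `0` is the same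
as exchanging the vacancy parameters of the two ends of the third leg (the leg flip
`(i, a) ↦ (i, a + [i = 2])`, written inline so that this file declares no definitions). -/
theorem cxWeight_one_eq (lam : ℝ) (x : Fin 3 × ZMod 2 → ℝ) :
    cxWeight 1 lam x =
      cxWeight 0 lam (x ∘ fun p : Fin 3 × ZMod 2 => (p.1, if p.1 = 2 then p.2 + 1 else p.2)) := by
  set φ : Fin 3 × ZMod 2 → Fin 3 × ZMod 2 := fun p => (p.1, if p.1 = 2 then p.2 + 1 else p.2) with hφ
  -- the leg flip is an involution
  have hφφ : Function.Involutive φ := by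
    rintro ⟨i, a⟩
    by_cases hi : i = 2
    · simp [hφ, hi, add_assoc, zmod2_add_self]
    · simp [hφ, hi]
  -- its lift to the ten complex vertices (inner vertices fixed)
  set ψ : CxVert → CxVert := Sum.map φ id with hψ
  have hψψ : Function.Involutive ψ := by
    rintro (p | S')
    · simp [hψ, hφφ p]
    · simp [hψ]
  have hψinj : Function.Injective ψ := hψψ.injective
  -- charge `1` is charge `0` seen through `ψ`
  have hrel : ∀ u v : CxVert, cxRel 1 u v ↔ cxRel 0 (ψ u) (ψ v) := by
    rintro (⟨i, a⟩ | S') (⟨i', a'⟩ | S'')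
    · simp [cxRel, hψ]
    · simp [cxRel, hψ]
    · simp only [cxRel, hψ, hφ, Sum.map_inr, Sum.map_inl, id]
      rw [bit_one_eq]
      by_cases hi : i' = 2
      · simp only [hi, if_true]
        constructor
        · intro h; rw [← h, add_assoc, zmod2_add_self, add_zero]
        · intro h
          have := congrArg (· + 1) h
          simpa [add_assoc, zmod2_add_self] using this
      · simp [hi]
    · simp [cxRel, hψ]
  have hadj : ∀ u v : CxVert, (cxGraph 1).Adj u v ↔ (cxGraph 0).Adj (ψ u) (ψ v) := fun u v => by
    rw [cxGraph_adj, cxGraph_adj, hrel u v, hrel v u, hψinj.ne_iff]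
  -- the induced permutations
  let Φ : (Fin 3 × ZMod 2) ≃ (Fin 3 × ZMod 2) := hφφ.toPerm φ
  let Ψ : CxVert ≃ CxVert := hψψ.toPerm ψ
  have hΦ : ∀ p, Φ p = φ p := fun p => rfl
  have hΨ : ∀ u, Ψ u = ψ u := fun u => rfl
  have hind : ∀ J : Finset CxVert, (cxGraph 1).IsIndepSet (↑J : Set CxVert) ↔
      (cxGraph 0).IsIndepSet (↑(J.map Ψ.toEmbedding) : Set CxVert) := by
    intro J
    constructor
    · intro h x' hx y hy hxy
      obtain ⟨u, hu, rfl⟩ := Finset.mem_map.1 (Finset.mem_coe.1 hx)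
      obtain ⟨v, hv, rfl⟩ := Finset.mem_map.1 (Finset.mem_coe.1 hy)
      have huv : u ≠ v := fun h' => hxy (by rw [h'])
      intro hadj'
      exact h (Finset.mem_coe.2 hu) (Finset.mem_coe.2 hv) huv ((hadj u v).2 hadj')
    · intro h u hu v hv huv hadj'
      have hu' : Ψ.toEmbedding u ∈ J.map Ψ.toEmbedding := Finset.mem_map_of_mem _ hu
      have hv' : Ψ.toEmbedding v ∈ J.map Ψ.toEmbedding := Finset.mem_map_of_mem _ hv
      have huv' : Ψ.toEmbedding u ≠ Ψ.toEmbedding v := fun h' => huv (Ψ.injective h')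
      exact h (Finset.mem_coe.2 hu') (Finset.mem_coe.2 hv') huv' ((hadj u v).1 hadj')
  -- reindex the outer sum along `J ↦ J.map Ψ` and the inner product along `Φ`
  unfold cxWeight
  refine Fintype.sum_equiv (Equiv.finsetCongr Ψ) _ _ fun J => ?_
  rw [Equiv.finsetCongr_apply, Finset.card_map]
  by_cases hJ : (cxGraph 1).IsIndepSet (↑J : Set CxVert)
  · rw [if_pos hJ, if_pos ((hind J).1 hJ)]
    congr 1
    refine Fintype.prod_equiv Φ _ _ fun p => ?_
    have hmem : ((Sum.inl p : CxVert) ∈ J) ↔ ((Sum.inl (Φ p) : CxVert) ∈ J.map Ψ.toEmbedding) := by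
      constructor
      · intro h
        refine Finset.mem_map.2 ⟨Sum.inl p, h, ?_⟩
        show Ψ (Sum.inl p) = Sum.inl (Φ p)
        rw [hΨ, hΦ, hψ]; rfl
      · intro h
        obtain ⟨u, hu, hu'⟩ := Finset.mem_map.1 h
        have : u = Sum.inl p := by
          apply Ψ.injective
          rw [show (Ψ.toEmbedding u : CxVert) = Ψ u from rfl] at hu'
          rw [hu', hΨ, hψ]; rfl
        rw [← this]; exact hu
    have hval : (x ∘ φ) (Φ p) = x p := by
      show x (φ (φ p)) = x p
      rw [hφφ p]
    by_cases hp : (Sum.inl p : CxVert) ∈ J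
    · rw [if_pos hp, if_pos (hmem.1 hp), hval]
    · rw [if_neg hp, if_neg (fun h => hp (hmem.2 h))]
  · rw [if_neg hJ, if_neg (fun h => hJ ((hind J).2 h))]

/-- At a constant port pattern the complex factor does not see the charge. -/
theorem cxW_const_eq (lam qp qm : ℝ) (s : Bool) (e : ZMod 2) :
    cxW lam qp qm e (fun _ => s) = cxW lam qp qm 0 (fun _ => s) := by
  rcases zmod2_eq_zero_or_one e with rfl | rfl
  · rfl
  · unfold cxW
    rw [cxWeight_one_eq]
    rfl

/-! ## Monotonicity of the complex factor -/

/-- The complex factor is at least the empty configuration's weight `1`. -/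
theorem one_le_cxWeight (e : ZMod 2) {lam : ℝ} (hlam : 0 ≤ lam) {x : Fin 3 × ZMod 2 → ℝ}
    (hx : ∀ p, 0 ≤ x p) : 1 ≤ cxWeight e lam x := by
  unfold cxWeight
  have hterm : ∀ J : Finset CxVert, 0 ≤ (if (cxGraph e).IsIndepSet (↑J : Set CxVert) then
      lam ^ J.card * ∏ p : Fin 3 × ZMod 2, (if (Sum.inl p : CxVert) ∈ J then x p else 1) else 0) := by
    intro J
    split_ifs
    · exact mul_nonneg (pow_nonneg hlam _)
        (Finset.prod_nonneg fun p _ => by split_ifs <;> [exact hx p; exact zero_le_one])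
    · exact le_rfl
  have hempty : (if (cxGraph e).IsIndepSet (↑(∅ : Finset CxVert) : Set CxVert) then
      lam ^ (∅ : Finset CxVert).card *
        ∏ p : Fin 3 × ZMod 2, (if (Sum.inl p : CxVert) ∈ (∅ : Finset CxVert) then x p else 1) else 0) = 1 := by
    have h : (cxGraph e).IsIndepSet ((∅ : Finset CxVert) : Set CxVert) := by
      simp [SimpleGraph.IsIndepSet, Set.Pairwise]
    rw [if_pos h]
    simp
  calc (1 : ℝ) = _ := hempty.symm
    _ ≤ _ := Finset.single_le_sum (fun J _ => hterm J) (Finset.mem_univ (∅ : Finset CxVert))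

/-- The complex factor is monotone in the vacancy parameters (coefficientwise positivity). -/
theorem cxWeight_mono (e : ZMod 2) {lam : ℝ} (hlam : 0 ≤ lam) {x x' : Fin 3 × ZMod 2 → ℝ}
    (hx : ∀ p, 0 ≤ x p) (hxx' : ∀ p, x p ≤ x' p) : cxWeight e lam x ≤ cxWeight e lam x' := by
  unfold cxWeight
  refine Finset.sum_le_sum fun J _ => ?_
  split_ifs
  · refine mul_le_mul_of_nonneg_left ?_ (pow_nonneg hlam _)
    refine Finset.prod_le_prod (fun p _ => ?_) (fun p _ => ?_)
    · split_ifs <;> [exact hx p; exact zero_le_one]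
    · split_ifs <;> [exact hxx' p; exact le_rfl]
  · exact le_rfl

/-- The normalised complex factor is positive. -/
theorem cxW_pos {lam qp qm : ℝ} (hlam : 0 ≤ lam) (hqm1 : qm ≤ 1) (hqp1 : qp ≤ 1) (e : ZMod 2)
    (y : Fin 3 × ZMod 2 → Bool) : 0 < cxW lam qp qm e y := by
  unfold cxW
  refine div_pos (lt_of_lt_of_le zero_lt_one (one_le_cxWeight e hlam fun p => ?_)) (pow_pos (by linarith) _)
  unfold occP; split_ifs <;> linarith

/-- The complex factor is maximal when all six ports are in phase `−` (vacancy `1 − q⁻` everywhere). -/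
theorem cxW_le_allMinus {lam qp qm : ℝ} (hlam : 0 ≤ lam) (hle : qm ≤ qp) (hqp1 : qp ≤ 1) (e : ZMod 2)
    (y : Fin 3 × ZMod 2 → Bool) : cxW lam qp qm e y ≤ cxW lam qp qm e (fun _ => false) := by
  unfold cxW
  refine div_le_div_of_nonneg_right (cxWeight_mono e hlam (fun p => ?_) (fun p => ?_)) (pow_nonneg (by linarith) _)
  · unfold occP; split_ifs <;> linarith
  · unfold occP
    cases y p
    · simp
    · simp only [if_true, Bool.false_eq_true, if_false]
      linarith

/-! ## The pair coupling is load-bearing -/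

/-- With no pair coupling the weight of a phase vector is the product of the complex factors. -/
theorem pwW_zero_coupling {M : ℕ} (R : RotGraph M 3) (lam qp qm : ℝ) (κ₂ : ℕ) (c : Fin M → ZMod 2)
    (Y : Dart M 3 × ZMod 2 → Bool) :
    pwW R lam qp qm 0 κ₂ c Y =
      ∏ w : Fin M, cxW lam qp qm (c w) (fun p => Y ((canonEnd R (w, p.1)).1, p.2)) ^ κ₂ := by
  unfold pwW pairW
  simp

/-- **`stub_tseitinGap` is false without its coupling hypothesis.** Switch the pair coupling off
(`κ₁ = 0`; then `hcouple` would read `κ₂ (M log ρ_F + g) ≤ 0`, impossible for `κ₂ ≥ 1`): for EVERY 3-regular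
rotation map `R`, every `w₀`, all `q⁻ < q⁺ < 1` (the stub's `0 < q⁻` is not even needed), `λ > 0` and
`κ₂ ≥ 1`, and even granted strict charge
visibility `Ψ(1) < Ψ(0)`, no reference vector `Y₀` under charge `0` dominates all phase vectors under the odd
charge boosted by `e^{κ₂ g}` — the all-`−` vector is charge-blind (`cxW_const_eq`) and maximal
(`cxW_le_allMinus`), so it beats every `Y₀` by the factor `e^{κ₂ g} > 1`.  Hence any proof of the stub must use
`hcouple` (equivalently: aligned pairs must be penalised). -/
theorem tseitinGap_false_without_coupling {M : ℕ} (R : RotGraph M 3) (w₀ : Fin M) {lam qp qm : ℝ}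
    (hlam : 0 < lam) (hlt : qm < qp) (hqp : qp < 1)
    (hΨ : pwPsi lam qp qm 1 < pwPsi lam qp qm 0) {κ₂ : ℕ} (hκ₂ : 1 ≤ κ₂) :
    ¬ ∃ Y₀ : Dart M 3 × ZMod 2 → Bool, ∀ Y : Dart M 3 × ZMod 2 → Bool,
      pwW R lam qp qm 0 κ₂ (Pi.single w₀ 1) Y *
          Real.exp (κ₂ * (pwPsi lam qp qm 0 - pwPsi lam qp qm 1)) ≤
        pwW R lam qp qm 0 κ₂ 0 Y₀ := by
  rintro ⟨Y₀, h⟩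
  have hmain := h (fun _ => false)
  set Fm : ℝ := cxW lam qp qm 0 (fun _ => false) with hFm
  have hFm_pos : 0 < Fm := cxW_pos hlam.le (hlt.le.trans hqp.le) hqp.le 0 _
  -- the all-`−` vector under the odd charge weighs `Fm ^ κ₂` at every base vertex
  have hL : pwW R lam qp qm 0 κ₂ (Pi.single w₀ 1) (fun _ => false) = ∏ _w : Fin M, Fm ^ κ₂ := by
    rw [pwW_zero_coupling]
    refine Finset.prod_congr rfl fun w _ => ?_
    rw [cxW_const_eq lam qp qm false]
  -- every vector under charge `0` weighs at most that
  have hR : pwW R lam qp qm 0 κ₂ 0 Y₀ ≤ ∏ _w : Fin M, Fm ^ κ₂ := by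
    rw [pwW_zero_coupling]
    refine Finset.prod_le_prod (fun w _ => pow_nonneg (cxW_pos hlam.le (hlt.le.trans hqp.le) hqp.le _ _).le _)
      (fun w _ => ?_)
    exact pow_le_pow_left₀ (cxW_pos hlam.le (hlt.le.trans hqp.le) hqp.le _ _).le
      (cxW_le_allMinus hlam.le hlt.le hqp.le _ _) κ₂
  have hP : 0 < ∏ _w : Fin M, Fm ^ κ₂ := Finset.prod_pos fun w _ => pow_pos hFm_pos _
  have hexp : 1 < Real.exp (κ₂ * (pwPsi lam qp qm 0 - pwPsi lam qp qm 1)) := by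
    have hk : (0 : ℝ) < κ₂ := Nat.cast_pos.2 hκ₂
    have ht : (0 : ℝ) < κ₂ * (pwPsi lam qp qm 0 - pwPsi lam qp qm 1) := mul_pos hk (sub_pos.2 hΨ)
    have := Real.exp_lt_exp.2 ht
    rwa [Real.exp_zero] at this
  rw [hL] at hmain
  have : (∏ _w : Fin M, Fm ^ κ₂) * Real.exp (κ₂ * (pwPsi lam qp qm 0 - pwPsi lam qp qm 1)) ≤
      ∏ _w : Fin M, Fm ^ κ₂ := hmain.trans hR
  have h2 : (∏ _w : Fin M, Fm ^ κ₂) * 1 < (∏ _w : Fin M, Fm ^ κ₂) *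
      Real.exp (κ₂ * (pwPsi lam qp qm 0 - pwPsi lam qp qm 1)) := mul_lt_mul_of_pos_left hexp hP
  linarith

end Summit.PneNP.PneNP.Theorems.PolyDepthTwinsAbove.Negative
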